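import Literature.Geometry.Kaehler.ComplexTorusCentralWeilTypeExceptionalWeilClasses
import Literature.Geometry.Kaehler.ComplexTorusStablyNondegenerateProductPerfectFactor
import Literature.Geometry.Kaehler.ComplexTorusDivisorClassesPushforward
import HarnessLib

/-!
# Moonen–Zarhin 1999, dimension 5, cases (e) and (f): `X ∼ X₁² × X₂` or `X ∼ X₀ × X₁ × X₂` with `X₁ × X₂` in
# case (a) — condition (D) fails, «`𝒟²(X) ≠ ℬ²(X)` and `𝒟³(X) ≠ ℬ³(X)`»; more generally every `Z × (T × E_τ)`
# with a case-(a) factor is degenerate in codimensions `2` and `dim Z + 2`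

Layer `Literature/Geometry/Kaehler`, namespace `Literature.Geometry.Kaehler.ComplexTorus`; lane `lit-hodgefound`
(Track 2 foundations library), Layer A4; p17, generation 54, row g54-#5 (self-proposed sequel of ✔ g54-#3
`ComplexTorusNonSimpleAbelianFourfoldCaseADegenerate` — case (a) fails (D) — and g54-#4
`ComplexTorusCentralWeilTypeExceptionalWeilClasses` — `𝒟²(T × E_τ) ≠ ℬ²(T × E_τ)`).  THEOREMS ONLY (no definition, no
named fact, net debt 0).

## Source, verbatim

B. Moonen, Yu. G. Zarhin [MoonenZarhin1999LowDim], *Hodge classes on abelian varieties of low dimension*,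
Math. Ann. **315** (1999) (materialised `paper:arxiv-math_9901113`):

* the dimension-`5` cases (p0001 L129–L134): «(e) The abelian variety `X` is isogenous to a product `X₁² × X₂`, where `X₁`
  and `X₂` are as in (a).  (f) The abelian variety `X` is isogenous to a product `X₀ × X₁ × X₂`, where `X₀` is an elliptic
  curve, where `X₁` and `X₂` are as in (a), and such that `X₀` and `X₁` are not isogenous.» — (a) (p0001 L77–L80): «`X₁`
  is an elliptic curve with complex multiplication by an imaginary quadratic field `k` and … `X₂` is a simple abelian
  threefold such that there exists an embedding `k ↪ End⁰(X₂)`»;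
* Thm. (0.2) (1), (2) (p0001 L147–L162): in case (e) «the Hodge ring `ℬ•(X)` is generated by the subalgebra `𝒟•(X)` of
  divisor classes together with the subspaces `W_{k,α}`.  The Hodge group `Hg(X)` is strictly contained in
  `Sp_D(V,φ)`»; in case (f) «`ℬ•(X)` is generated by the divisor classes `𝒟•(X)` together with the pull-backs of the
  Weil classes in `W_k ⊂ ℬ²(X₁ × X₂)`»;
* p0002 L12–L15: «Further we remark that in the cases (e) and (f) the pull-backs of the Weil classes are needed to generate
  the Hodge ring of `X`; in these cases we have `𝒟²(X) ≠ ℬ²(X)` and `𝒟³(X) ≠ ℬ³(X)`.»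

## Rendering (the tree's vocabulary) and what is proved

`Y = T × E_τ` is `prodPeriod Ψ' (ellipticPeriod hτ)` with `T` (`Ψ'`) a simple polarised complex abelian threefold, `E_τ` a CM
curve (`ellipticEnd hτ ≠ ⊥`) and `k = ℚ[τ] ↪ End⁰(T)` (`Nonempty (ℚ[τ] →ₐ[ℚ] End_ℚ(T))`) — case (a); `Z` is any
complex abelian variety.  §1: `Z × Y` and everything isogenous to it FAILS (D) (g54-#3 + «a factor of a stably
nondegenerate abelian variety is stably nondegenerate», Gordon 7.6.1, the tree's
`IsAbelianVariety.forall_divisorClasses_powPeriod_eq_hodgeClasses_right_of_prod`); `𝒟²(Z × Y) ≠ ℬ²(Z × Y)` (g54-#4 + descent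
of `𝒟ᵖ = ℬᵖ` to a factor in the same codimension) and `𝒟^{g+2}(Z × Y) ≠ ℬ^{g+2}(Z × Y)`, `g = dim Z` (g54-#4 + Milne's
shift `[pt_Z] × w`, the tree's `divisorClasses_eq_hodgeClasses_of_prod`), both isogeny-invariant.  §2 = case (e) (`Z = X₁ = E_τ`,
`X ∼ X₁² × X₂ ≅ X₁ × (X₂ × X₁)`): (D) fails, `𝒟²(X) ≠ ℬ²(X)`, `𝒟³(X) ≠ ℬ³(X)`.  §3 = case (f) (`Z = X₀ = E_σ`; the printed
proviso «`X₀` and `X₁` not isogenous» only separates (f) from (e) and is not needed for these three conclusions): the same.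

NOT here: the generation statements of (0.2) (1)–(2) and «`Hg(X)` strictly contained in `Sp_D(V,φ)`» for case (e).

## References

* [MoonenZarhin1999LowDim] B. Moonen, Yu. G. Zarhin, Math. Ann. 315 (1999), Introduction (a), (e), (f), Thm. (0.2) (1), (2) and
  p. 712 («`𝒟²(X) ≠ ℬ²(X)` and `𝒟³(X) ≠ ℬ³(X)`»).
* [Gordon1999HodgeAVSurvey] B. B. Gordon, *A survey of the Hodge conjecture for abelian varieties*, 7.6.1.
* [Milne1999LefschetzClasses] J. S. Milne, Duke Math. J. 96 (1999), §4 Prop. 4.8 (footnote 6), §5 Cor. 5.5.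
* [Lange2023AbelianVarietiesComplex] H. Lange (2023), §7.3.3 Exercise (1)(b), §2.4.4 Cor. 2.4.26, §1.1.2 (products).
-/

noncomputable section

open Module Matrix Complex Function

namespace Literature.Geometry.Kaehler

namespace ComplexTorus

/-! ## §1 Products `Z × (T × E_τ)` with a case-(a) factor -/

section Factor

variable {κ : Type} [Fintype κ] [DecidableEq κ] {E' : Type} [NormedAddCommGroup E'] [NormedSpace ℂ E']
  [FiniteDimensional ℂ E'] {Ψ' : (κ → ℝ) ≃L[ℝ] E'} {τ : ℂ}
  {ιZ : Type*} [Fintype ιZ] [DecidableEq ιZ] {EZ : Type*} [NormedAddCommGroup EZ] [NormedSpace ℂ EZ]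
  [FiniteDimensional ℂ EZ] {ΦZ : (ιZ → ℝ) ≃L[ℝ] EZ}
  {κ₀ : Type*} [Fintype κ₀] [DecidableEq κ₀] {E₀ : Type*} [NormedAddCommGroup E₀] [NormedSpace ℂ E₀]
  {Ψ : (κ₀ → ℝ) ≃L[ℝ] E₀}

omit [FiniteDimensional ℂ EZ] in
/-- **`Z × (T × E_τ)` FAILS (D) when `T × E_τ` is in case (a)** (`Z` any complex abelian variety): a factor of a stably
nondegenerate abelian variety is stably nondegenerate, and `T × E_τ` is not (g54-#3).
[cite: MoonenZarhin1999LowDim, Thm. (0.1) (1), (4) and Introduction (e), (f) (p0001 L129–L134)] [cite: Gordon1999HodgeAVSurvey, 7.6.1 (first remark)] -/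
theorem IsSimple.not_forall_divisorClasses_powPeriod_prod_prod_ellipticPeriod_eq_hodgeClasses_of_nonempty_algHom
    (hT : IsSimple Ψ') (hA : IsAbelianVariety Ψ') (h3 : finrank ℂ E' = 3) (hτ : τ.im ≠ 0) (hE : ellipticEnd hτ ≠ ⊥)
    (hemb : Nonempty (Algebra.adjoin ℚ {τ} →ₐ[ℚ] endAlgRat Ψ')) (hZ : IsAbelianVariety ΦZ) :
    ¬ ∀ k p : ℕ, divisorClasses (powPeriod (prodPeriod ΦZ (prodPeriod Ψ' (ellipticPeriod hτ))) k) p =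
      hodgeClasses (powPeriod (prodPeriod ΦZ (prodPeriod Ψ' (ellipticPeriod hτ))) k) p := fun hD ↦ by
  obtain ⟨k, p, hkp⟩ :=
    hT.exists_divisorClasses_powPeriod_prod_ellipticPeriod_ne_hodgeClasses_of_nonempty_algHom hA h3 hτ hE hemb
  exact hkp (hZ.forall_divisorClasses_powPeriod_eq_hodgeClasses_right_of_prod
    (hA.prod (isAbelianVariety_ellipticPeriod hτ)) hD k p)

omit [FiniteDimensional ℂ EZ] in
/-- **EVERY `X ∼ Z × (T × E_τ)` WITH A CASE-(a) FACTOR FAILS (D).** [cite: MoonenZarhin1999LowDim, Thm. (0.1) (1), (4) and Introduction (e), (f)]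
[cite: Gordon1999HodgeAVSurvey, 7.6.1] [cite: Lange2023AbelianVarietiesComplex, §7.3.3 Exercise (1)(b)] -/
theorem IsIsogenous.exists_divisorClasses_powPeriod_ne_hodgeClasses_of_prod_prod_ellipticPeriod_of_nonempty_algHom
    {hτ : τ.im ≠ 0} (hiso : IsIsogenous Ψ (prodPeriod ΦZ (prodPeriod Ψ' (ellipticPeriod hτ)))) (hZ : IsAbelianVariety ΦZ)
    (hT : IsSimple Ψ') (hA : IsAbelianVariety Ψ') (h3 : finrank ℂ E' = 3) (hE : ellipticEnd hτ ≠ ⊥)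
    (hemb : Nonempty (Algebra.adjoin ℚ {τ} →ₐ[ℚ] endAlgRat Ψ')) :
    ∃ k p : ℕ, divisorClasses (powPeriod Ψ k) p ≠ hodgeClasses (powPeriod Ψ k) p := by
  by_contra h
  push Not at h
  exact hT.not_forall_divisorClasses_powPeriod_prod_prod_ellipticPeriod_eq_hodgeClasses_of_nonempty_algHom hA h3 hτ hE hemb
    hZ (hiso.forall_powPeriod_divisorClasses_eq_hodgeClasses_iff.1 h)

omit [FiniteDimensional ℂ EZ] in
/-- **`𝒟²(Z × (T × E_τ)) ≠ ℬ²(Z × (T × E_τ))`** (case (a) factor): `𝒟² = ℬ²` would descend to the factor `T × E_τ`, where it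
fails (g54-#4). [cite: MoonenZarhin1999LowDim, p0002 L12–L15 («`𝒟²(X) ≠ ℬ²(X)`») and Thm. (0.1) (1)] [cite: Gordon1999HodgeAVSurvey, 7.6.1 (first remark)] -/
theorem IsSimple.divisorClasses_prod_prod_ellipticPeriod_two_ne_hodgeClasses_of_nonempty_algHom (hT : IsSimple Ψ')
    (hA : IsAbelianVariety Ψ') (h3 : finrank ℂ E' = 3) (hτ : τ.im ≠ 0) (hE : ellipticEnd hτ ≠ ⊥)
    (hemb : Nonempty (Algebra.adjoin ℚ {τ} →ₐ[ℚ] endAlgRat Ψ')) (hZ : IsAbelianVariety ΦZ) :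
    divisorClasses (prodPeriod ΦZ (prodPeriod Ψ' (ellipticPeriod hτ))) 2 ≠
      hodgeClasses (prodPeriod ΦZ (prodPeriod Ψ' (ellipticPeriod hτ))) 2 := fun h2 ↦
  hT.divisorClasses_prod_ellipticPeriod_two_ne_hodgeClasses_of_nonempty_algHom hA h3 hτ hE hemb
    (divisorClasses_eq_hodgeClasses_snd_of_eq ΦZ (prodPeriod Ψ' (ellipticPeriod hτ))
      (hZ.prod (hA.prod (isAbelianVariety_ellipticPeriod hτ))) h2)

omit [FiniteDimensional ℂ EZ] in
/-- `𝒟²(X) ≠ ℬ²(X)` for every `X ∼ Z × (T × E_τ)` with a case-(a) factor. [cite: MoonenZarhin1999LowDim, p0002 L12–L15]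
[cite: Lange2023AbelianVarietiesComplex, §7.3.3 Exercise (1)(b)] -/
theorem IsIsogenous.divisorClasses_two_ne_hodgeClasses_of_prod_prod_ellipticPeriod_of_nonempty_algHom {hτ : τ.im ≠ 0}
    (hiso : IsIsogenous Ψ (prodPeriod ΦZ (prodPeriod Ψ' (ellipticPeriod hτ)))) (hZ : IsAbelianVariety ΦZ)
    (hT : IsSimple Ψ') (hA : IsAbelianVariety Ψ') (h3 : finrank ℂ E' = 3) (hE : ellipticEnd hτ ≠ ⊥)
    (hemb : Nonempty (Algebra.adjoin ℚ {τ} →ₐ[ℚ] endAlgRat Ψ')) : divisorClasses Ψ 2 ≠ hodgeClasses Ψ 2 := fun h2 ↦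
  hT.divisorClasses_prod_prod_ellipticPeriod_two_ne_hodgeClasses_of_nonempty_algHom hA h3 hτ hE hemb hZ
    ((hiso.divisorClasses_eq_hodgeClasses_iff _ _ 2).1 h2)

/-- **`𝒟^{g+2}(Z × (T × E_τ)) ≠ ℬ^{g+2}(Z × (T × E_τ))`, `g = dim Z`** (case (a) factor): an exceptional class
`w ∈ ℬ²(T × E_τ) ∖ 𝒟²` gives the exceptional class `[pt_Z] × w` in codimension `g + 2` (Milne: `pr₂*` preserves `𝒟•`).
[cite: MoonenZarhin1999LowDim, p0002 L12–L15 («`𝒟³(X) ≠ ℬ³(X)`»)] [cite: Milne1999LefschetzClasses, §4 Prop. 4.8 (footnote 6) and §5 Cor. 5.5] -/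
theorem IsSimple.divisorClasses_prod_prod_ellipticPeriod_finrank_add_two_ne_hodgeClasses_of_nonempty_algHom (hT : IsSimple Ψ')
    (hA : IsAbelianVariety Ψ') (h3 : finrank ℂ E' = 3) (hτ : τ.im ≠ 0) (hE : ellipticEnd hτ ≠ ⊥)
    (hemb : Nonempty (Algebra.adjoin ℚ {τ} →ₐ[ℚ] endAlgRat Ψ')) (hZ : IsAbelianVariety ΦZ) :
    divisorClasses (prodPeriod ΦZ (prodPeriod Ψ' (ellipticPeriod hτ))) (finrank ℂ EZ + 2) ≠
      hodgeClasses (prodPeriod ΦZ (prodPeriod Ψ' (ellipticPeriod hτ))) (finrank ℂ EZ + 2) := fun h ↦ by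
  obtain ⟨ηZ, hηZ⟩ := hZ
  obtain ⟨θ, hθ⟩ := hA.prod (isAbelianVariety_ellipticPeriod hτ)
  have hcard : Fintype.card ιZ = 2 * finrank ℂ EZ := card_eq_two_mul_finrank ΦZ
  exact hT.divisorClasses_prod_ellipticPeriod_two_ne_hodgeClasses_of_nonempty_algHom hA h3 hτ hE hemb
    (divisorClasses_eq_hodgeClasses_of_prod ΦZ (prodPeriod Ψ' (ellipticPeriod hτ)) hηZ.isNSForm
      (fun v hv ↦ hηZ.exists_apply_ne_zero _ v hv) hθ.isNSForm (fun v hv ↦ hθ.exists_apply_ne_zero _ v hv)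
      (Fintype.equivFinOfCardEq hcard).symm (p := 2) h)

/-- `𝒟^{g+2}(X) ≠ ℬ^{g+2}(X)` for every `X ∼ Z × (T × E_τ)` with a case-(a) factor, `g = dim Z`.
[cite: MoonenZarhin1999LowDim, p0002 L12–L15] [cite: Lange2023AbelianVarietiesComplex, §7.3.3 Exercise (1)(b)] -/
theorem IsIsogenous.divisorClasses_finrank_add_two_ne_hodgeClasses_of_prod_prod_ellipticPeriod_of_nonempty_algHom {hτ : τ.im ≠ 0}
    (hiso : IsIsogenous Ψ (prodPeriod ΦZ (prodPeriod Ψ' (ellipticPeriod hτ)))) (hZ : IsAbelianVariety ΦZ)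
    (hT : IsSimple Ψ') (hA : IsAbelianVariety Ψ') (h3 : finrank ℂ E' = 3) (hE : ellipticEnd hτ ≠ ⊥)
    (hemb : Nonempty (Algebra.adjoin ℚ {τ} →ₐ[ℚ] endAlgRat Ψ')) :
    divisorClasses Ψ (finrank ℂ EZ + 2) ≠ hodgeClasses Ψ (finrank ℂ EZ + 2) := fun h ↦
  hT.divisorClasses_prod_prod_ellipticPeriod_finrank_add_two_ne_hodgeClasses_of_nonempty_algHom hA h3 hτ hE hemb hZ
    ((hiso.divisorClasses_eq_hodgeClasses_iff _ _ _).1 h)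

end Factor

/-! ## §2 Case (e): `X ∼ X₁² × X₂` (`X₁ = E_τ` a CM curve, `X₂ = T` a simple threefold, `ℚ[τ] ↪ End⁰(T)`) -/

section CaseE

variable {κ : Type} [Fintype κ] [DecidableEq κ] {E' : Type} [NormedAddCommGroup E'] [NormedSpace ℂ E']
  [FiniteDimensional ℂ E'] {Ψ' : (κ → ℝ) ≃L[ℝ] E'} {τ : ℂ}
  {κ₀ : Type*} [Fintype κ₀] [DecidableEq κ₀] {E₀ : Type*} [NormedAddCommGroup E₀] [NormedSpace ℂ E₀]
  {Ψ : (κ₀ → ℝ) ≃L[ℝ] E₀}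

omit [FiniteDimensional ℂ E'] in
/-- `X₁² × X₂ ∼ X₁ × (X₂ × X₁)`. [cite: Lange2023AbelianVarietiesComplex, §1.1.2 (products, p. 21) and Cor. 1.1.16] -/
private theorem cef_isIsogenous_ellipticPow_two_prod (hτ : τ.im ≠ 0) :
    IsIsogenous (prodPeriod (powPeriod (ellipticPeriod hτ) 2) Ψ')
      (prodPeriod (ellipticPeriod hτ) (prodPeriod Ψ' (ellipticPeriod hτ))) := by
  have h1 : IsIsogenous (prodPeriod (powPeriod (ellipticPeriod hτ) 2) Ψ')
      (prodPeriod (prodPeriod (ellipticPeriod hτ) (ellipticPeriod hτ)) Ψ') :=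
    (IsIsogenous.symm _ _ ((IsIsogenous.refl (ellipticPeriod hτ)).prod_powPeriod_two (IsIsogenous.refl _))).prod
      (IsIsogenous.refl Ψ')
  have h2 : IsIsomorphic (prodPeriod (prodPeriod (ellipticPeriod hτ) (ellipticPeriod hτ)) Ψ')
      (prodPeriod (ellipticPeriod hτ) (prodPeriod Ψ' (ellipticPeriod hτ))) :=
    (isIsomorphic_prodPeriod_assoc (ellipticPeriod hτ) (ellipticPeriod hτ) Ψ').trans
      ((IsIsomorphic.refl (ellipticPeriod hτ)).prod (isIsomorphic_prodPeriod_comm (ellipticPeriod hτ) Ψ'))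
  exact IsIsogenous.trans _ _ _ h1 h2.isIsogenous

/-- **MZ99, CASE (e): `X ∼ X₁² × X₂` FAILS CONDITION (D)** (`X₁ = E_τ` with complex multiplication by `k = ℚ(τ)`, `X₂` a
simple abelian threefold with `k ↪ End⁰(X₂)`). [cite: MoonenZarhin1999LowDim, Introduction (e) (p0001 L129–L130), Thm. (0.2) (1) (p0001 L147–L155) and p0002 L12–L15]
[cite: Gordon1999HodgeAVSurvey, 7.6.1] -/
theorem IsIsogenous.exists_divisorClasses_powPeriod_ne_hodgeClasses_of_ellipticPow_two_prod_of_nonempty_algHom {hτ : τ.im ≠ 0}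
    (he : IsIsogenous Ψ (prodPeriod (powPeriod (ellipticPeriod hτ) 2) Ψ')) (hT : IsSimple Ψ') (hA : IsAbelianVariety Ψ')
    (h3 : finrank ℂ E' = 3) (hE : ellipticEnd hτ ≠ ⊥) (hemb : Nonempty (Algebra.adjoin ℚ {τ} →ₐ[ℚ] endAlgRat Ψ')) :
    ∃ k p : ℕ, divisorClasses (powPeriod Ψ k) p ≠ hodgeClasses (powPeriod Ψ k) p :=
  (IsIsogenous.trans _ _ _ he
    (cef_isIsogenous_ellipticPow_two_prod hτ)).exists_divisorClasses_powPeriod_ne_hodgeClasses_of_prod_prod_ellipticPeriod_of_nonempty_algHom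
    (isAbelianVariety_ellipticPeriod hτ) hT hA h3 hE hemb

/-- **MZ99, CASE (e): `𝒟²(X) ≠ ℬ²(X)`.** [cite: MoonenZarhin1999LowDim, p0002 L12–L15 and Thm. (0.2) (1)] -/
theorem IsIsogenous.divisorClasses_two_ne_hodgeClasses_of_ellipticPow_two_prod_of_nonempty_algHom {hτ : τ.im ≠ 0}
    (he : IsIsogenous Ψ (prodPeriod (powPeriod (ellipticPeriod hτ) 2) Ψ')) (hT : IsSimple Ψ') (hA : IsAbelianVariety Ψ')
    (h3 : finrank ℂ E' = 3) (hE : ellipticEnd hτ ≠ ⊥) (hemb : Nonempty (Algebra.adjoin ℚ {τ} →ₐ[ℚ] endAlgRat Ψ')) :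
    divisorClasses Ψ 2 ≠ hodgeClasses Ψ 2 :=
  (IsIsogenous.trans _ _ _ he
    (cef_isIsogenous_ellipticPow_two_prod hτ)).divisorClasses_two_ne_hodgeClasses_of_prod_prod_ellipticPeriod_of_nonempty_algHom
    (isAbelianVariety_ellipticPeriod hτ) hT hA h3 hE hemb

/-- **MZ99, CASE (e): `𝒟³(X) ≠ ℬ³(X)`.** [cite: MoonenZarhin1999LowDim, p0002 L12–L15 and Thm. (0.2) (1)] [cite: Milne1999LefschetzClasses, §5 Cor. 5.5] -/
theorem IsIsogenous.divisorClasses_three_ne_hodgeClasses_of_ellipticPow_two_prod_of_nonempty_algHom {hτ : τ.im ≠ 0}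
    (he : IsIsogenous Ψ (prodPeriod (powPeriod (ellipticPeriod hτ) 2) Ψ')) (hT : IsSimple Ψ') (hA : IsAbelianVariety Ψ')
    (h3 : finrank ℂ E' = 3) (hE : ellipticEnd hτ ≠ ⊥) (hemb : Nonempty (Algebra.adjoin ℚ {τ} →ₐ[ℚ] endAlgRat Ψ')) :
    divisorClasses Ψ 3 ≠ hodgeClasses Ψ 3 := by
  have h := (IsIsogenous.trans _ _ _ he
    (cef_isIsogenous_ellipticPow_two_prod hτ)).divisorClasses_finrank_add_two_ne_hodgeClasses_of_prod_prod_ellipticPeriod_of_nonempty_algHom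
    (isAbelianVariety_ellipticPeriod hτ) hT hA h3 hE hemb
  rwa [Module.finrank_self] at h

end CaseE

/-! ## §3 Case (f): `X ∼ X₀ × X₁ × X₂` (`X₀ = E_σ` any elliptic curve, `X₁ = E_τ`, `X₂ = T` as in (a)) -/

section CaseF

variable {κ : Type} [Fintype κ] [DecidableEq κ] {E' : Type} [NormedAddCommGroup E'] [NormedSpace ℂ E']
  [FiniteDimensional ℂ E'] {Ψ' : (κ → ℝ) ≃L[ℝ] E'} {σ τ : ℂ}
  {κ₀ : Type*} [Fintype κ₀] [DecidableEq κ₀] {E₀ : Type*} [NormedAddCommGroup E₀] [NormedSpace ℂ E₀]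
  {Ψ : (κ₀ → ℝ) ≃L[ℝ] E₀}

omit [FiniteDimensional ℂ E'] in
/-- `X₀ × (X₁ × X₂) ≅ X₀ × (X₂ × X₁)`. [cite: Lange2023AbelianVarietiesComplex, §1.1.2 (products, p. 21)] -/
private theorem cef_isIsogenous_elliptic_prod_elliptic_prod (hσ : σ.im ≠ 0) (hτ : τ.im ≠ 0) :
    IsIsogenous (prodPeriod (ellipticPeriod hσ) (prodPeriod (ellipticPeriod hτ) Ψ'))
      (prodPeriod (ellipticPeriod hσ) (prodPeriod Ψ' (ellipticPeriod hτ))) :=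
  ((IsIsomorphic.refl (ellipticPeriod hσ)).prod (isIsomorphic_prodPeriod_comm (ellipticPeriod hτ) Ψ')).isIsogenous

/-- **MZ99, CASE (f): `X ∼ X₀ × X₁ × X₂` FAILS CONDITION (D)** (`X₀` an elliptic curve, `X₁ = E_τ` a CM curve, `X₂` a simple
abelian threefold with `ℚ(τ) ↪ End⁰(X₂)`; the printed proviso «`X₀` and `X₁` are not isogenous» separates (f) from (e) and is not
needed for this conclusion). [cite: MoonenZarhin1999LowDim, Introduction (f) (p0001 L131–L134), Thm. (0.2) (2) (p0001 L156–L162) and p0002 L12–L15]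
[cite: Gordon1999HodgeAVSurvey, 7.6.1] -/
theorem IsIsogenous.exists_divisorClasses_powPeriod_ne_hodgeClasses_of_elliptic_prod_elliptic_prod_of_nonempty_algHom
    {hσ : σ.im ≠ 0} {hτ : τ.im ≠ 0} (hf : IsIsogenous Ψ (prodPeriod (ellipticPeriod hσ) (prodPeriod (ellipticPeriod hτ) Ψ')))
    (hT : IsSimple Ψ') (hA : IsAbelianVariety Ψ') (h3 : finrank ℂ E' = 3) (hE : ellipticEnd hτ ≠ ⊥)
    (hemb : Nonempty (Algebra.adjoin ℚ {τ} →ₐ[ℚ] endAlgRat Ψ')) :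
    ∃ k p : ℕ, divisorClasses (powPeriod Ψ k) p ≠ hodgeClasses (powPeriod Ψ k) p :=
  (IsIsogenous.trans _ _ _ hf (cef_isIsogenous_elliptic_prod_elliptic_prod hσ
    hτ)).exists_divisorClasses_powPeriod_ne_hodgeClasses_of_prod_prod_ellipticPeriod_of_nonempty_algHom
    (isAbelianVariety_ellipticPeriod hσ) hT hA h3 hE hemb

/-- **MZ99, CASE (f): `𝒟²(X) ≠ ℬ²(X)`.** [cite: MoonenZarhin1999LowDim, p0002 L12–L15 and Thm. (0.2) (2)] -/
theorem IsIsogenous.divisorClasses_two_ne_hodgeClasses_of_elliptic_prod_elliptic_prod_of_nonempty_algHom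
    {hσ : σ.im ≠ 0} {hτ : τ.im ≠ 0} (hf : IsIsogenous Ψ (prodPeriod (ellipticPeriod hσ) (prodPeriod (ellipticPeriod hτ) Ψ')))
    (hT : IsSimple Ψ') (hA : IsAbelianVariety Ψ') (h3 : finrank ℂ E' = 3) (hE : ellipticEnd hτ ≠ ⊥)
    (hemb : Nonempty (Algebra.adjoin ℚ {τ} →ₐ[ℚ] endAlgRat Ψ')) : divisorClasses Ψ 2 ≠ hodgeClasses Ψ 2 :=
  (IsIsogenous.trans _ _ _ hf (cef_isIsogenous_elliptic_prod_elliptic_prod hσ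
    hτ)).divisorClasses_two_ne_hodgeClasses_of_prod_prod_ellipticPeriod_of_nonempty_algHom
    (isAbelianVariety_ellipticPeriod hσ) hT hA h3 hE hemb

/-- **MZ99, CASE (f): `𝒟³(X) ≠ ℬ³(X)`.** [cite: MoonenZarhin1999LowDim, p0002 L12–L15 and Thm. (0.2) (2)] [cite: Milne1999LefschetzClasses, §5 Cor. 5.5] -/
theorem IsIsogenous.divisorClasses_three_ne_hodgeClasses_of_elliptic_prod_elliptic_prod_of_nonempty_algHom
    {hσ : σ.im ≠ 0} {hτ : τ.im ≠ 0} (hf : IsIsogenous Ψ (prodPeriod (ellipticPeriod hσ) (prodPeriod (ellipticPeriod hτ) Ψ')))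
    (hT : IsSimple Ψ') (hA : IsAbelianVariety Ψ') (h3 : finrank ℂ E' = 3) (hE : ellipticEnd hτ ≠ ⊥)
    (hemb : Nonempty (Algebra.adjoin ℚ {τ} →ₐ[ℚ] endAlgRat Ψ')) : divisorClasses Ψ 3 ≠ hodgeClasses Ψ 3 := by
  have h := (IsIsogenous.trans _ _ _ hf (cef_isIsogenous_elliptic_prod_elliptic_prod hσ
    hτ)).divisorClasses_finrank_add_two_ne_hodgeClasses_of_prod_prod_ellipticPeriod_of_nonempty_algHom
    (isAbelianVariety_ellipticPeriod hσ) hT hA h3 hE hemb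
  rwa [Module.finrank_self] at h

end CaseF

end ComplexTorus

end Literature.Geometry.Kaehler
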